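import Summits.BirchSwinnertonDyer.BirchSwinnertonDyer.Theorems.ManinLocalTwoThreeKummerCubeRootSigmaPrelims
import Summits.BirchSwinnertonDyer.BirchSwinnertonDyer.Theorems.ManinLocalTwoThreeSigmaCubeRootKummerCharacter
import Summits.BirchSwinnertonDyer.Rank1Residual.ManinAdditive.UDCKummerLine
import HarnessLib

/-!
# (AN2-c) `Γ₀(N)`-automorphy of the σ-Kummer function `t_s·W_u(c·E_f)`: stabiliser EXACTLY `Γ_T`
(route `ManinLocalTwoThree`, crux C3 `ManinPrimeToThreeAtNine` stmt-BirchSwinnertonDyer-22968; cell bsd-f2-manin, p2 gen 17;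
`--supports stmt-BirchSwinnertonDyer-22968`; the automorphy clauses of C3 v23's `stub_kummerCubeRootModularFormWitness`, for the weight-`0` building
block `G(τ) = shortT D τ · sigmaCubeRoot D.L u e (c·eichlerIntegral D.f τ)` of (AN2)'s modular form `F = κ·G·P(j)^e·Δ^k`)

PROVED (no sorry, no definition):
* `smul_eichlerIntegral_gamma_smul` — `c·E_f(γτ) = c·E_f(τ) + μ_γ`, `μ_γ := c·{∞,γ∞}_f ∈ Λ_E` (tree `eichlerIntegral_smul_sub_holds`,
  `smul_periodLattice_le`); `shortT_gamma_smul` — `t_s(γτ) = t_s(τ)` (`℘`, `℘′` are `Λ`-periodic);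
* `exists_multiplier_gamma` — `∃ ρ_γ`, `W_u(w + μ_γ) = ρ_γ·W_u(w)` for all `w` (p3's `sigmaCubeRoot_add_zsmul_add_zsmul`) and hence
  **`G(γτ) = ρ_γ·G(τ)` for all `τ`** (junk values included);
* **`forall_gamma_smul_eq_of_kummerPeriodTrivial`** — `KummerPeriodTrivial D u γ ⟹ ∀ τ, G(γτ) = G(τ)` (p3's `sigmaCubeRoot_periodic_iff`, ⟸);
* `exists_shortT_mul_sigmaCubeRoot_ne_zero` — `G ≢ 0` (high in the strip `G = Φ(w)` with `Φ(0) ≠ 0`, my prelims p727564);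
* **`kummerPeriodTrivial_of_forall_gamma_smul_eq`** — `(∀ τ, G(γτ) = G(τ)) ⟹ KummerPeriodTrivial D u γ` (`ρ_γ = 1` at a point where `G ≠ 0`,
  then p3's iff, ⟹).
So the STABILISER of `G` in `Γ₀(N)` is exactly an's `Γ_T = {γ : KummerPeriodTrivial D u γ}`; since `P(j)^e·Δ^k` is level-one, the same holds for
(AN2)'s `F` in weight `12k` once it is built (that construction — poles via the algebraicity of `j` on `φ⁻¹(E[2])`, growth at the other cusps
— remains OPEN).  BSD is not proved by this; Manin's conjecture is not proved; C3/C2 OPEN. [folklore]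
-/

set_option autoImplicit false
-- lint-debt: the directory name repeats the summit name (sibling precedent `ManinLocalTwoThreeSigmaCubeRootKummerCharacter.lean`)
set_option linter.dupNamespace false

noncomputable section

open scoped Topology PeriodPair MatrixGroups
open Complex Filter CongruenceSubgroup
open Literature.NumberTheory.EllipticCurves Literature.NumberTheory.EllipticCurves.ModularForms
open Summit.BirchSwinnertonDyer.Rank1Residual.ManinAdditive.CuspidalKummer
open Summit.BirchSwinnertonDyer.Rank1Residual.ManinAdditive.CuspidalKummerThree
open Summit.BirchSwinnertonDyer.Rank1Residual.ManinAdditive.KummerCubeMonodromy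
open Summit.BirchSwinnertonDyer.Rank1Residual.ManinAdditive.UDCKummerLine
open Summit.BirchSwinnertonDyer.BirchSwinnertonDyer.Theorems.ManinLocalTwoThree.KummerCubeAnalytic
open Summit.BirchSwinnertonDyer.BirchSwinnertonDyer.Theorems.ManinLocalTwoThree.KummerCover

namespace Summit.BirchSwinnertonDyer.BirchSwinnertonDyer.Theorems.ManinLocalTwoThree.KummerCubeRootDictionary

variable {W : WeierstrassCurve ℚ} {N : ℕ} [NeZero N]

/-! ### §1 `w(γτ) = w(τ) + μ_γ`, `μ_γ ∈ Λ`; `t_s` is `Γ₀(N)`-invariant -/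

/-- `μ_γ = c·{∞,γ∞}_f ∈ Λ_E`. [folklore] -/
theorem smul_cuspSymbol_mem_lattice (D : ModularParametrizationData W N) (γ : Gamma0 N) :
    (D.c : ℂ) * cuspSymbol D.f γ ∈ D.L.lattice :=
  D.smul_periodLattice_le _ (cuspSymbol_mem_periodLattice D.f γ)

/-- `c·E_f(γτ) = c·E_f(τ) + c·{∞,γ∞}_f` (Manin). [cite: Manin1972, Prop. 1.4] -/
theorem smul_eichlerIntegral_gamma_smul (D : ModularParametrizationData W N) (γ : Gamma0 N) (τ : UpperHalfPlane) :
    (D.c : ℂ) * eichlerIntegral D.f ((γ : SL(2, ℤ)) • τ) = (D.c : ℂ) * eichlerIntegral D.f τ + (D.c : ℂ) * cuspSymbol D.f γ := by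
  have h := eichlerIntegral_smul_sub_holds D.f γ τ
  linear_combination (D.c : ℂ) * h

/-- `t_s(γτ) = t_s(τ)`: `℘`, `℘′` are `Λ`-periodic. [folklore] -/
theorem shortT_gamma_smul (D : ModularParametrizationData W N) (γ : Gamma0 N) (τ : UpperHalfPlane) :
    shortT D ((γ : SL(2, ℤ)) • τ) = shortT D τ := by
  have hμ := smul_cuspSymbol_mem_lattice D γ
  rw [shortT, shortT, shortX, shortX, shortY, shortY, smul_eichlerIntegral_gamma_smul,
    show (D.c : ℂ) * cuspSymbol D.f γ = ((⟨_, hμ⟩ : D.L.lattice) : ℂ) from rfl,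
    PeriodPair.weierstrassP_add_coe, PeriodPair.derivWeierstrassP_add_coe]

/-! ### §2 The multiplier of `G = t_s·W_u(w)` under `γ ∈ Γ₀(N)` -/

/-- **`G(γτ) = ρ_γ·G(τ)`** with the multiplier `ρ_γ` of `W_u` along `μ_γ ∈ Λ` (the Kummer character; junk values included). [folklore] -/
theorem exists_multiplier_gamma (D : ModularParametrizationData W N) (u e : ℂ) (γ : Gamma0 N) :
    ∃ ρ : ℂ, (∀ w : ℂ, sigmaCubeRoot D.L u e (w + (D.c : ℂ) * cuspSymbol D.f γ) = ρ * sigmaCubeRoot D.L u e w) ∧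
      ∀ τ : UpperHalfPlane,
        shortT D ((γ : SL(2, ℤ)) • τ) * sigmaCubeRoot D.L u e ((D.c : ℂ) * eichlerIntegral D.f ((γ : SL(2, ℤ)) • τ)) =
          ρ * (shortT D τ * sigmaCubeRoot D.L u e ((D.c : ℂ) * eichlerIntegral D.f τ)) := by
  obtain ⟨n₁, n₂, hn⟩ := PeriodPair.mem_lattice.mp (smul_cuspSymbol_mem_lattice D γ)
  refine ⟨cexp (((n₁ : ℂ) * (e * D.L.ω₁ - 3 * u * D.L.η₁) + (n₂ : ℂ) * (e * D.L.ω₂ - 3 * u * D.L.η₂)) / 3), fun w => ?_,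
    fun τ => ?_⟩
  · rw [← hn]
    exact sigmaCubeRoot_add_zsmul_add_zsmul D.L u e n₁ n₂ w
  · rw [shortT_gamma_smul, smul_eichlerIntegral_gamma_smul, ← hn, sigmaCubeRoot_add_zsmul_add_zsmul D.L u e n₁ n₂]
    ring

/-- **`KummerPeriodTrivial D u γ ⟹ G` is `γ`-invariant** (p3's `sigmaCubeRoot_periodic_iff`, ⟸). [folklore] -/
theorem forall_gamma_smul_eq_of_kummerPeriodTrivial (D : ModularParametrizationData W N) {u : ℂ} (hu : u ∉ D.L.lattice)
    {m₁ m₂ : ℤ} (h3u : (m₁ : ℂ) * D.L.ω₁ + (m₂ : ℂ) * D.L.ω₂ = 3 * u) (γ : Gamma0 N) (hK : KummerPeriodTrivial D u γ)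
    (τ : UpperHalfPlane) :
    shortT D ((γ : SL(2, ℤ)) • τ) * sigmaCubeRoot D.L u (m₁ * D.L.η₁ + m₂ * D.L.η₂) ((D.c : ℂ) * eichlerIntegral D.f ((γ : SL(2, ℤ)) • τ)) =
      shortT D τ * sigmaCubeRoot D.L u (m₁ * D.L.η₁ + m₂ * D.L.η₂) ((D.c : ℂ) * eichlerIntegral D.f τ) := by
  have hper := (sigmaCubeRoot_periodic_iff D.L hu h3u (smul_cuspSymbol_mem_lattice D γ)).mpr hK
  rw [shortT_gamma_smul, smul_eichlerIntegral_gamma_smul, hper]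

/-- `G ≢ 0`: high in the strip `G(τ) = Φ(w(τ))` with `Φ(0) ≠ 0` (prelims `exists_analytic_shortT_mul_sigmaCubeRoot`). [folklore] -/
theorem exists_shortT_mul_sigmaCubeRoot_ne_zero [W.IsElliptic] (D : ModularParametrizationData W N) (hc0 : D.c ≠ 0) {u : ℂ} (hu : u ∉ D.L.lattice)
    (e : ℂ) : ∃ τ : UpperHalfPlane, shortT D τ * sigmaCubeRoot D.L u e ((D.c : ℂ) * eichlerIntegral D.f τ) ≠ 0 := by
  obtain ⟨Φ, P₃, hΦan, hΦ0, hP₃d, hP₃0, hΦeq⟩ := exists_analytic_shortT_mul_sigmaCubeRoot D hc0 hu e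
  have hf1 : cuspCoeff D.f 1 = 1 := by
    rw [D.isNewformOf.2 1, W.isMultiplicative_LFunction.map_one]; simp
  have hc : (D.c : ℂ) ≠ 0 := Int.cast_ne_zero.mpr hc0
  have hP : ContinuousAt (fun w => Φ w * P₃ w) 0 := hΦan.continuousAt.mul hP₃d.continuous.continuousAt
  have hP0 : Φ 0 * P₃ 0 ≠ 0 := mul_ne_zero hΦ0 (by rw [hP₃0]; norm_num)
  have hev := eventually_smul_qGerm_notMem D.f hf1 D.L hc hP hP0
  obtain ⟨B, hB⟩ := exists_im_bound_of_eventually hev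
  obtain ⟨τ, hτ⟩ := exists_im_gt B
  obtain ⟨hwΛ, hne⟩ := hB τ hτ
  rw [qGerm_apply] at hwΛ hne
  refine ⟨τ, ?_⟩
  rw [hΦeq τ hwΛ (right_ne_zero_of_mul hne)]
  exact left_ne_zero_of_mul hne

/-- **`G` `γ`-invariant ⟹ `KummerPeriodTrivial D u γ`** (the multiplier is `1` at a point where `G ≠ 0`; p3's iff, ⟹). [folklore] -/
theorem kummerPeriodTrivial_of_forall_gamma_smul_eq [W.IsElliptic] (D : ModularParametrizationData W N) (hc0 : D.c ≠ 0) {u : ℂ}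
    (hu : u ∉ D.L.lattice) {m₁ m₂ : ℤ} (h3u : (m₁ : ℂ) * D.L.ω₁ + (m₂ : ℂ) * D.L.ω₂ = 3 * u) (γ : Gamma0 N)
    (hG : ∀ τ : UpperHalfPlane,
      shortT D ((γ : SL(2, ℤ)) • τ) * sigmaCubeRoot D.L u (m₁ * D.L.η₁ + m₂ * D.L.η₂) ((D.c : ℂ) * eichlerIntegral D.f ((γ : SL(2, ℤ)) • τ)) =
        shortT D τ * sigmaCubeRoot D.L u (m₁ * D.L.η₁ + m₂ * D.L.η₂) ((D.c : ℂ) * eichlerIntegral D.f τ)) :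
    KummerPeriodTrivial D u γ := by
  set e : ℂ := m₁ * D.L.η₁ + m₂ * D.L.η₂ with he
  obtain ⟨ρ, hρW, hρG⟩ := exists_multiplier_gamma D u e γ
  obtain ⟨τ₀, hτ₀⟩ := exists_shortT_mul_sigmaCubeRoot_ne_zero D hc0 hu e
  have hρ1 : ρ = 1 := by
    have h := hρG τ₀
    rw [hG τ₀] at h
    -- `G τ₀ = ρ · G τ₀`, `G τ₀ ≠ 0`
    have := mul_right_cancel₀ hτ₀ (h.symm.trans (one_mul _).symm)
    exact this
  refine (sigmaCubeRoot_periodic_iff D.L hu h3u (smul_cuspSymbol_mem_lattice D γ)).mp fun w => ?_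
  rw [hρW w, hρ1, one_mul]

end Summit.BirchSwinnertonDyer.BirchSwinnertonDyer.Theorems.ManinLocalTwoThree.KummerCubeRootDictionary

end
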